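import Summits.PneNP.PneNP.Theorems.SymmetryBudgetNoHiddenOrderBranchSumDefs

/-!
# BranchSum VI (definitions): mixed boundaries of cells on a refinement path

Definitions for the frozen-boundary facts of `SymmetryBudgetNoHiddenOrderBranchSumFrozen.lean`
(CG84-FLATNESS.md §10.1, §12; route `PneNP/SymmetryBudget`, dichotomy `NoHiddenOrder` /
`WindowBarrier`, stmt-PneNP-14781 / stmt-PneNP-2145), on top of `BranchSum.RefinementPath`:

* `IsMixed G v Y` — `v` is adjacent to some but not to all vertices of the finite set `Y`
  (the negation of "homogeneous", cf. hypothesis H4 `RefinementPath.removal`);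
* `RefinementPath.boundary R k w` — the MIXED BOUNDARY at node `k` of the node-`k` cell of `w`:
  the vertices of `W k` mixed on it (by Fact S this is the switching-neighbourhood of the cell);
* `RefinementPath.hull R j Z` — the node-`j` hull of a vertex set (all vertices of `W j` sharing a
  node-`j` colour with it; the hull of a node-`(j+1)` cell is its node-`j` cell);
* `RefinementPath.nPieces R k w j` — the number of node-`j` cells met by the boundary.
-/

namespace Summit.PneNP.PneNP.Theorems

open Finset

namespace BranchSum

variable {V : Type*}

/-- `v` is MIXED on `Y` (w.r.t. `G`): adjacent to some vertex of `Y` and non-adjacent to some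
vertex of `Y`. -/
def IsMixed (G : SimpleGraph V) (v : V) (Y : Finset V) : Prop :=
  (∃ y ∈ Y, G.Adj v y) ∧ ∃ y ∈ Y, ¬ G.Adj v y

/-- `IsMixed` is decidable. -/
instance (G : SimpleGraph V) [DecidableRel G.Adj] (v : V) (Y : Finset V) : Decidable (IsMixed G v Y) := by
  unfold IsMixed; infer_instance

variable [DecidableEq V] {G : SimpleGraph V} [DecidableRel G.Adj] {N : ℕ}

namespace RefinementPath

variable (R : RefinementPath G N)

/-- The MIXED BOUNDARY at node `k` of the node-`k` cell of `w`: the vertices of `W k` mixed on it. -/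
def boundary (k : ℕ) (w : V) : Finset V := (R.W k).filter fun v => IsMixed G v (R.cell k w)

/-- The node-`j` HULL of a set of vertices: all vertices of `W j` sharing a node-`j` colour with it. -/
def hull (j : ℕ) (Z : Finset V) : Finset V := (R.W j).filter fun v => ∃ z ∈ Z, R.col j v = R.col j z

/-- The number of node-`j` cells met by the boundary (at node `k`) of the node-`k` cell of `w`. -/
def nPieces (k : ℕ) (w : V) (j : ℕ) : ℕ := ((R.boundary k w).image fun b => R.cell j b).card

end RefinementPath

end BranchSum

end Summit.PneNP.PneNP.Theorems
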